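import Summits.CriticalPhenomena.PercolationContinuityZ3.Theorems.PercNearOneGluingNoHeavyPcintWindowCertZ3K6Check1
import Summits.CriticalPhenomena.PercolationContinuityZ3.Theorems.PercNearOneGluingNoHeavyPcintWindowCertZ3K6Check2
import Summits.CriticalPhenomena.PercolationContinuityZ3.Theorems.PercNearOneGluingNoHeavyPcintWindowCertZ3K6Check3
import Summits.CriticalPhenomena.PercolationContinuityZ3.Theorems.PercNearOneGluingNoHeavyPcintWindowCertZ3K6Check4
import Summits.CriticalPhenomena.PercolationContinuityZ3.Theorems.PercNearOneGluingNoHeavyPcintWindowCertZ3K6Check5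
import Summits.CriticalPhenomena.PercolationContinuityZ3.Theorems.PercNearOneGluingNoHeavyPcintWindowCertZ3K6Check6
import Summits.CriticalPhenomena.PercolationContinuityZ3.Theorems.PercNearOneGluingNoHeavyPcintWindowCertZ3K6Check7
import Summits.CriticalPhenomena.PercolationContinuityZ3.Theorems.PercNearOneGluingNoHeavyPcintWindowCertZ3K6Check8
import HarnessLib

/-!
# PCINT lane: **`p_c^bond(ℤ³) ≥ 0.2149`** — kernel-checked window certificate (memory 6, chord-weighted walks)

Cell `prim-pcint`, seat `prim-pcint-2`; memo `run/shared/lean/prim/pcint/REDUCTIONS.md` §R2/§B3, INTERVAL-PLAN §10.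
Does NOT build on p205010.  Assembles the eight kernel-checked chunks of Collatz–Wielandt rows (`…Z3K6Check1..8`), the
decoding of every window from its base-6 code (`decodeW_surj`), the soundness of the computable acceptance test and
chord count (`hok`, `hc`), and `le_criticalProb_zd_of_windowCert`.  Printed best lower bound before this lane:
`1/4.7387 = 0.2110` (Pönitz–Tittmann 2000 + Hammersley); this file: `0.2149`, no external certificate (the lane's
two-implementation certificates reach `0.2192` for this kind at memory 14, `0.2218` for kind `chordrand`).
-/

namespace Summit.CriticalPhenomena.PercolationContinuityZ3.Theorems.Pcint

open Finset Literature.Probability.Percolation Literature.Probability.LatticeModels Z3K6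

/-- All `7776` coded Collatz–Wielandt rows check. [folklore] -/
theorem Z3K6.checkAll : checkRange 0 7776 = true :=
  checkRange_of_split (checkRange_of_split (checkRange_of_split checkRange_1 checkRange_2)
    (checkRange_of_split checkRange_3 checkRange_4))
    (checkRange_of_split (checkRange_of_split checkRange_5 checkRange_6)
    (checkRange_of_split checkRange_7 checkRange_8))

/-- **The 7776 Collatz–Wielandt inequalities** `10^5 · rowN u ≤ 99995 · 10^24 · v(u)` (λ = 0.99995). [folklore] -/
theorem Z3K6.rowN_le (u : Fin 5 → Fin 3 × Bool) : 100000 * rowN u ≤ 99995 * 10 ^ 24 * vNat u :=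
  rowN_le_of_checkAll checkAll u

/-- **`p_c^bond(ℤ³) ≥ 0.2149`** (kernel-checked window certificate, memory 6, chord-weighted; printed best lower
bound 0.2110). [folklore] -/
theorem criticalProb_Z3_ge_02149 : (0.2149 : ℝ) ≤ criticalProb (zdGraph 3) 0 := by
  have hp : ((⟨2149 / 10000, by norm_num, by norm_num⟩ : unitInterval) : ℝ) = 0.2149 := by norm_num
  rw [← hp]
  refine le_criticalProb_zd_of_windowCert ((0 : Fin 3), true) okc cc hok hc _ (fun u => (vNat u : ℝ))
    (vmin := 56125) (vmax := 100000) (lam := 99995 / 100000) (by norm_num)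
    (fun u => by exact_mod_cast (vNat_bounds u).1) (fun u => by exact_mod_cast (vNat_bounds u).2)
    (by norm_num) (by norm_num) fun u => ?_
  have hN : (100000 * rowN u : ℝ) ≤ 99995 * 10 ^ 24 * vNat u := by exact_mod_cast rowN_le u
  have hrow : (∑ a : Fin 3 × Bool, if okc u a then (2149 / 10000 : ℝ) * (1 - 2149 / 10000) ^ cc u a * (vNat (wshift u a) : ℝ)
      else 0) ≤ (rowN u : ℝ) / 10 ^ 24 := by
    rw [rowN, Nat.cast_sum, Finset.sum_div]
    refine Finset.sum_le_sum fun a _ => ?_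
    split_ifs with h
    · exact weight_le_termN _ _
    · simp
  have : (rowN u : ℝ) / 10 ^ 24 ≤ 99995 / 100000 * (vNat u : ℝ) := by
    rw [div_le_iff₀ (by positivity)]
    nlinarith
  exact hrow.trans this

end Summit.CriticalPhenomena.PercolationContinuityZ3.Theorems.Pcint
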